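import Mathlib
import HarnessLib
import HarnessLib.Audit
import Summits.ValiantsHypothesis.ValiantsHypothesis.Theorems.LacunarySymmetroidMatrixDescartesBinomialLead
import Summits.ValiantsHypothesis.ValiantsHypothesis.Theorems.LacunarySymmetroidMatrixDescartesZeroChangeFloorDictionary
import Summits.ValiantsHypothesis.ValiantsHypothesis.Theorems.LacunarySymmetroidMatrixDescartesZeroChangeConcavityBudget

/-!
# ValiantsHypothesis / LacunarySymmetroid — crux `MatrixDescartes` (stmt-ValiantsHypothesis-18050, V1), LINE (A) «product_plus_one»:
# the CONCAVITY BUDGET in FLOOR CURRENCY — `OneChangeFloorK3` follows from a LINEAR budget on the BAD critical points (`M ≤ 0`)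

Second half of the concavity budget (first half: ✓ `…ZeroChangeConcavityBudget`, the abstract count
`posCrit Φ ≤ 2·#{non-good positive critical points} + #{positive roots} + 1` for ANY real polynomial, GOOD = «`Φ′ = 0`, `ΦΦ″ < 0`»).
Here the polynomial is the row product `Φ = ∏_j g_j`, `g_j = row a c a_{j0} a_{j1} a_{j2}` (`0 < a < c`) of LINE (A)'s floor, and the pen's
CONCAVITY CRITERION (✓ `concavity_identity`, card `Ideas/arrangement-concavity-dip-count.md`, NOTE §56.7: at an off-root positive critical point
with middle-letter Pick sum `M(t) = Σ_j a_{j1}t^a/g_j(t) > 0` one has `Φ(t)Φ″(t) < 0`) identifies the non-good points off the roots as the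
BAD points `M ≤ 0` (equivalently `T ≥ 0`: the top letters win, since `aM + cT = tΦ′/Φ = 0`):

* `card_crit_Ioo_le_two_mul_card_notGood_add_one` — WINDOW-LOCAL abstract form: on a root-free interval `(u, v)` the positive critical
  points of any `Φ` number `≤ 2·#{non-good ones in (u, v)} + 1`; company form `card_crit_Ioo_prod_rows_le` with BAD = `M ≤ 0`
  (the currency of the per-window sector files `eulerNumerator_roots_Icc_le_…`);
* `concavityCriterion_strict` — the criterion freed of the unused side condition `a_{j2} ≠ 0` of ✓ `concavityCriterion`;
* ★ `posCrit_prod_rows_le_concavityBudget` — ANY company: `posCrit Φ ≤ 2·#{t > 0 : Φ′(t) = 0, Φ(t) ≠ 0, M(t) ≤ 0} + 3·#{positive roots of Φ} + 1`;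
  sharpened bad set `M < 0 ∨ (every row critical at t)` in `posCrit_prod_rows_le_concavityBudget_strict` (via ✓ `concavityCriterion_of_nonneg`;
  for a company with a `(+,−,−)` row, never critical, BAD = «top letters win STRICTLY»);
* `card_posRoots_row_le_one_of_oneChange` / `card_posRoots_prod_rows_le_of_oneChange` — a one-change row (`¬(a₀a₁ < 0 ∧ a₁a₂ < 0)`, the
  floor's hypothesis verbatim) has at most ONE positive root (elementary: positive derivative at every positive root, up to the sign of the
  row), so the product of `m` of them has at most `m`;
* ★ `posCrit_prod_rows_le_concavityBudget_of_oneChange` — one-change companies: `posCrit Φ ≤ 2·#BAD + 3m + 1`;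
* ★ `floor_le_concavityBudget` — through the dictionary ✓ `card_posRoots_euler_bottom_eq_posCrit`: on every support `d₀ < d₁ < d₂`,
  `Z₊(eulerNumerator d a 0) ≤ 2·#BAD + 3m + 1` for every one-change company (`eulerNumerator` unfolded exactly as in the dictionary);
* ★★ `oneChangeFloorK3_of_badBudget` — «`#BAD ≤ B·m + B` for every one-change company on every support `0 < u < w`» ⇒ the body of
  `OneChangeFloorK3` VERBATIM, constant `2B + 3`.  The converse is trivial (bad points are critical points), so the floor is EQUIVALENT to a
  linear budget on `𝔅 = {t > 0 : Φ′(t) = 0, Φ(t) ≠ 0, M(t) ≤ 0}` — the card's successor cut C⁺, now for ALL companies (no genericity;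
  degenerate critical points are simply bad or good like the others).

HONEST FRAMING: a JOINT (reduction), def-free, no named facts, no sorry, standard axioms; it closes NO stub by name (`stub_oneChangeFloorK3`
needs the bad-point budget itself — open core: `(+,−,−)` rows at ratio `> 4`, mixed companies); `OneChangeFloorK3`, `EulerBoundK3`,
`ClassRowK3Linear`, `PPOPolyLaw`, `MatrixDescartes` (stmt-ValiantsHypothesis-18050) stay OPEN; `VP ≠ VNP` is NOT proved and nothing here bears on it.

[folklore] Elementary real analysis and counting; no citation needed.
-/

set_option linter.dupNamespace false

namespace Summit.ValiantsHypothesis.ValiantsHypothesis.Theorems.LacunarySymmetroidMatrixDescartes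

namespace ZeroChange

open Polynomial Finset Filter Topology


/-! ## §4b Window-local form of the abstract budget (for the per-window sector provers) -/

/-- **Window-local concavity budget** (any real polynomial): on a ROOT-FREE open interval `(u, v)`, the positive critical points of
`Φ` number at most twice the non-good ones plus one. -/
theorem card_crit_Ioo_le_two_mul_card_notGood_add_one (Φ : ℝ[X]) {u v : ℝ}
    (hnoroot : ∀ z, u < z → z < v → Φ.eval z ≠ 0) :
    (((derivative Φ).roots.toFinset.filter (fun t => 0 < t)).filter (fun t => u < t ∧ t < v)).card ≤
      2 * (((derivative Φ).roots.toFinset.filter (fun t => 0 < t)).filter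
          (fun t => (u < t ∧ t < v) ∧ ¬ (Φ.eval t * (derivative (derivative Φ)).eval t < 0))).card + 1 := by
  classical
  set S := (derivative Φ).roots.toFinset.filter (fun t => 0 < t) with hS
  set W := S.filter (fun t => u < t ∧ t < v) with hW
  set G := W.filter (fun t => Φ.eval t * (derivative (derivative Φ)).eval t < 0) with hG
  set N := W.filter (fun t => ¬ (Φ.eval t * (derivative (derivative Φ)).eval t < 0)) with hN
  have hWGN : G.card + N.card = W.card := card_filter_add_card_filter_not _
  have hN' : N = S.filter (fun t => (u < t ∧ t < v) ∧ ¬ (Φ.eval t * (derivative (derivative Φ)).eval t < 0)) := by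
    rw [hN, hW, filter_filter]
  by_cases hΦ' : derivative Φ = 0
  · have hS0 : S = ∅ := by simp [hS, hΦ']
    have hW0 : W = ∅ := by rw [hW, hS0, filter_empty]
    rw [hW0, card_empty]
    exact Nat.zero_le _
  have hmemS : ∀ t, t ∈ S ↔ 0 < t ∧ (derivative Φ).eval t = 0 := by
    intro t; rw [hS, mem_filter, Multiset.mem_toFinset, mem_roots hΦ', IsRoot.def, and_comm]
  have hsep : ∀ x ∈ G, ∀ y ∈ G, x < y → ∃ z ∈ N, x < z ∧ z < y := by
    intro x hx y hy hxy
    rw [hG, mem_filter, hW, mem_filter] at hx hy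
    obtain ⟨⟨hxS, hxu, -⟩, hx2⟩ := hx
    obtain ⟨⟨hyS, -, hyv⟩, hy2⟩ := hy
    obtain ⟨hx0, hx1⟩ := (hmemS x).1 hxS
    obtain ⟨-, hy1⟩ := (hmemS y).1 hyS
    obtain ⟨z, hz1, hz2, hz3, hz4⟩ := exists_crit_not_good_between Φ hxy hx1 hx2 hy1 hy2
      (fun z h1 h2 => hnoroot z (hxu.trans h1) (h2.trans hyv))
    refine ⟨z, ?_, hz1, hz2⟩
    rw [hN, mem_filter, hW, mem_filter]
    exact ⟨⟨(hmemS z).2 ⟨hx0.trans hz1, hz3⟩, hxu.trans hz1, hz2.trans hyv⟩, hz4⟩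
  have hGle := card_le_card_add_one_of_separated G N hsep
  rw [← hN']
  omega

/-! ## §5 Companies of trinomial rows: the non-good points off the roots have `M ≤ 0` (concavity criterion) -/

/-- **Concavity criterion, hypothesis-free strict form** (from ✓ `concavity_identity`): `0 < a < c`, a positive critical point `t`
of `Φ = ∏_j row a c …` off the roots with `M(t) > 0` has `Φ(t)·Φ″(t) < 0`.  (The landed `concavityCriterion` carries an unused
side condition `a_{j2} ≠ 0`; `concavityCriterion_of_nonneg` needs a row with `t g_j′(t) ≠ 0`; neither is needed when `M > 0`.) -/
theorem concavityCriterion_strict (m a c : ℕ) (ha : 0 < a) (hac : a < c) (co : Fin m → ℝ × ℝ × ℝ) {t : ℝ} (ht : 0 < t)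
    (hΦ : (∏ j, row a c (co j).1 (co j).2.1 (co j).2.2).eval t ≠ 0)
    (hcrit : (derivative (∏ j, row a c (co j).1 (co j).2.1 (co j).2.2)).eval t = 0)
    (hM : 0 < middleSum a c co t) :
    (∏ j, row a c (co j).1 (co j).2.1 (co j).2.2).eval t *
      (derivative (derivative (∏ j, row a c (co j).1 (co j).2.1 (co j).2.2))).eval t < 0 := by
  have hid := concavity_identity m a c co ht hΦ hcrit
  have hsq : 0 ≤ ∑ j, (t * (derivative (row a c (co j).1 (co j).2.1 (co j).2.2)).eval t /
      (row a c (co j).1 (co j).2.1 (co j).2.2).eval t) ^ 2 := sum_nonneg fun j _ => sq_nonneg _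
  have ha' : (0 : ℝ) < a := by exact_mod_cast ha
  have hac' : (a : ℝ) - c < 0 := by
    have : (a : ℝ) < c := by exact_mod_cast hac
    linarith
  have hneg : (a : ℝ) * ((a : ℝ) - c) * middleSum a c co t -
      ∑ j, (t * (derivative (row a c (co j).1 (co j).2.1 (co j).2.2)).eval t /
        (row a c (co j).1 (co j).2.1 (co j).2.2).eval t) ^ 2 < 0 := by
    nlinarith [mul_pos (mul_pos ha' (neg_pos.2 hac')) hM]
  have hΦ2 : 0 < ((∏ j, row a c (co j).1 (co j).2.1 (co j).2.2).eval t) ^ 2 := by positivity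
  by_contra hge
  push Not at hge
  have h0 : 0 ≤ t ^ 2 * ((∏ j, row a c (co j).1 (co j).2.1 (co j).2.2).eval t *
      (derivative (derivative (∏ j, row a c (co j).1 (co j).2.1 (co j).2.2))).eval t) := mul_nonneg (sq_nonneg t) hge
  rw [hid] at h0
  nlinarith [mul_pos hΦ2 (neg_pos.2 hneg)]

/-- **CONCAVITY BUDGET for a company** (`0 < a < c`, ANY rows): with `Φ = ∏_j row a c …`,
`posCrit Φ ≤ 2·#{t > 0 : Φ′(t) = 0, Φ(t) ≠ 0, M(t) ≤ 0} + 3·#{positive roots of Φ} + 1` — every positive critical point is a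
root, a BAD point (`M ≤ 0`, equivalently `T ≥ 0`: the top letters win), or a strict local maximum of `|Φ|`, and the strict local maxima
are separated by the other two kinds. -/
theorem posCrit_prod_rows_le_concavityBudget (m a c : ℕ) (ha : 0 < a) (hac : a < c) (co : Fin m → ℝ × ℝ × ℝ) :
    posCrit (∏ j, row a c (co j).1 (co j).2.1 (co j).2.2) ≤
      2 * (((derivative (∏ j, row a c (co j).1 (co j).2.1 (co j).2.2)).roots.toFinset.filter (fun t => 0 < t)).filter
          (fun t => (∏ j, row a c (co j).1 (co j).2.1 (co j).2.2).eval t ≠ 0 ∧ middleSum a c co t ≤ 0)).card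
        + 3 * ((∏ j, row a c (co j).1 (co j).2.1 (co j).2.2).roots.toFinset.filter (fun t => 0 < t)).card + 1 := by
  classical
  set Φ : ℝ[X] := ∏ j, row a c (co j).1 (co j).2.1 (co j).2.2 with hΦdef
  have h4 := posCrit_le_two_mul_card_notGood_add Φ
  set S := (derivative Φ).roots.toFinset.filter (fun t => 0 < t) with hS
  set R := Φ.roots.toFinset.filter (fun t => 0 < t) with hR
  set N := S.filter (fun t => ¬ (Φ.eval t * (derivative (derivative Φ)).eval t < 0)) with hN
  set B := S.filter (fun t => Φ.eval t ≠ 0 ∧ middleSum a c co t ≤ 0) with hB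
  have hsub : N ⊆ R ∪ B := by
    intro t ht
    rw [hN, mem_filter] at ht
    obtain ⟨htS, hng⟩ := ht
    have htS' := htS
    rw [hS, mem_filter, Multiset.mem_toFinset] at htS'
    obtain ⟨hmem, ht0⟩ := htS'
    have hΦ' : derivative Φ ≠ 0 := fun h => by rw [h, roots_zero] at hmem; exact Multiset.notMem_zero _ hmem
    have hΦ : Φ ≠ 0 := fun h => hΦ' (by rw [h, derivative_zero])
    have hcrit : (derivative Φ).eval t = 0 := (mem_roots hΦ').1 hmem
    by_cases hΦt : Φ.eval t = 0
    · refine mem_union_left _ ?_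
      rw [hR, mem_filter, Multiset.mem_toFinset, mem_roots hΦ]
      exact ⟨hΦt, ht0⟩
    · refine mem_union_right _ ?_
      rw [hB, mem_filter]
      refine ⟨htS, hΦt, ?_⟩
      by_contra hM
      push Not at hM
      exact hng (concavityCriterion_strict m a c ha hac co ht0 hΦt hcrit hM)
  have hNle : N.card ≤ R.card + B.card := (card_le_card hsub).trans (card_union_le _ _)
  omega

/-- **CONCAVITY BUDGET for a company, sharpened bad set**: a non-good off-root critical point has `M < 0` STRICTLY unless every row is
critical there (`t·g_j′(t) = 0` for all `j`; by ✓ `concavityCriterion_of_nonneg`).  For companies containing a `(+,−,−)`-type row (never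
critical) the bad set is therefore `{M < 0}` = «the top letters win strictly». -/
theorem posCrit_prod_rows_le_concavityBudget_strict (m a c : ℕ) (ha : 0 < a) (hac : a < c) (co : Fin m → ℝ × ℝ × ℝ) :
    posCrit (∏ j, row a c (co j).1 (co j).2.1 (co j).2.2) ≤
      2 * (((derivative (∏ j, row a c (co j).1 (co j).2.1 (co j).2.2)).roots.toFinset.filter (fun t => 0 < t)).filter
          (fun t => (∏ j, row a c (co j).1 (co j).2.1 (co j).2.2).eval t ≠ 0 ∧
            (middleSum a c co t < 0 ∨ ∀ j, t * (derivative (row a c (co j).1 (co j).2.1 (co j).2.2)).eval t = 0))).card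
        + 3 * ((∏ j, row a c (co j).1 (co j).2.1 (co j).2.2).roots.toFinset.filter (fun t => 0 < t)).card + 1 := by
  classical
  set Φ : ℝ[X] := ∏ j, row a c (co j).1 (co j).2.1 (co j).2.2 with hΦdef
  have h4 := posCrit_le_two_mul_card_notGood_add Φ
  set S := (derivative Φ).roots.toFinset.filter (fun t => 0 < t) with hS
  set R := Φ.roots.toFinset.filter (fun t => 0 < t) with hR
  set N := S.filter (fun t => ¬ (Φ.eval t * (derivative (derivative Φ)).eval t < 0)) with hN
  set B := S.filter (fun t => Φ.eval t ≠ 0 ∧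
    (middleSum a c co t < 0 ∨ ∀ j, t * (derivative (row a c (co j).1 (co j).2.1 (co j).2.2)).eval t = 0)) with hB
  have hsub : N ⊆ R ∪ B := by
    intro t ht
    rw [hN, mem_filter] at ht
    obtain ⟨htS, hng⟩ := ht
    have htS' := htS
    rw [hS, mem_filter, Multiset.mem_toFinset] at htS'
    obtain ⟨hmem, ht0⟩ := htS'
    have hΦ' : derivative Φ ≠ 0 := fun h => by rw [h, roots_zero] at hmem; exact Multiset.notMem_zero _ hmem
    have hΦ : Φ ≠ 0 := fun h => hΦ' (by rw [h, derivative_zero])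
    have hcrit : (derivative Φ).eval t = 0 := (mem_roots hΦ').1 hmem
    by_cases hΦt : Φ.eval t = 0
    · refine mem_union_left _ ?_
      rw [hR, mem_filter, Multiset.mem_toFinset, mem_roots hΦ]
      exact ⟨hΦt, ht0⟩
    · refine mem_union_right _ ?_
      rw [hB, mem_filter]
      refine ⟨htS, hΦt, ?_⟩
      by_contra hM
      push Not at hM
      obtain ⟨hM0, j, hj⟩ := hM
      exact hng (concavityCriterion_of_nonneg m a c ha hac co ht0 hΦt hcrit hM0 ⟨j, hj⟩)
  have hNle : N.card ≤ R.card + B.card := (card_le_card hsub).trans (card_union_le _ _)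
  omega

/-- **Window-local company budget**: on a root-free window `(u, v)` of a company on `0 < a < c`, the critical points number at
most `2·#{BAD points in the window} + 1`, BAD = `M ≤ 0` (the currency of the per-window sector files `eulerNumerator_roots_Icc_le_…`). -/
theorem card_crit_Ioo_prod_rows_le (m a c : ℕ) (ha : 0 < a) (hac : a < c) (co : Fin m → ℝ × ℝ × ℝ) {u v : ℝ}
    (hnoroot : ∀ z, u < z → z < v → (∏ j, row a c (co j).1 (co j).2.1 (co j).2.2).eval z ≠ 0) :
    (((derivative (∏ j, row a c (co j).1 (co j).2.1 (co j).2.2)).roots.toFinset.filter (fun t => 0 < t)).filter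
        (fun t => u < t ∧ t < v)).card ≤
      2 * (((derivative (∏ j, row a c (co j).1 (co j).2.1 (co j).2.2)).roots.toFinset.filter (fun t => 0 < t)).filter
          (fun t => (u < t ∧ t < v) ∧ middleSum a c co t ≤ 0)).card + 1 := by
  classical
  set Φ : ℝ[X] := ∏ j, row a c (co j).1 (co j).2.1 (co j).2.2 with hΦdef
  have h4 := card_crit_Ioo_le_two_mul_card_notGood_add_one Φ hnoroot
  set S := (derivative Φ).roots.toFinset.filter (fun t => 0 < t) with hS
  have hsub : S.filter (fun t => (u < t ∧ t < v) ∧ ¬ (Φ.eval t * (derivative (derivative Φ)).eval t < 0)) ⊆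
      S.filter (fun t => (u < t ∧ t < v) ∧ middleSum a c co t ≤ 0) := by
    intro t ht
    rw [mem_filter] at ht ⊢
    obtain ⟨htS, ⟨htu, htv⟩, hng⟩ := ht
    refine ⟨htS, ⟨htu, htv⟩, ?_⟩
    have htS' := htS
    rw [hS, mem_filter, Multiset.mem_toFinset] at htS'
    obtain ⟨hmem, ht0⟩ := htS'
    have hΦ' : derivative Φ ≠ 0 := fun h => by rw [h, roots_zero] at hmem; exact Multiset.notMem_zero _ hmem
    have hcrit : (derivative Φ).eval t = 0 := (mem_roots hΦ').1 hmem
    by_contra hM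
    push Not at hM
    exact hng (concavityCriterion_strict m a c ha hac co ht0 (hnoroot t htu htv) hcrit hM)
  have := card_le_card hsub
  omega

/-! ## §6 Floor currency: one-change rows have at most one positive root each, so `OneChangeFloorK3` follows from a
linear budget on the BAD critical points -/

/-- Negating the three letters negates the row. -/
theorem row_neg_letters (a c : ℕ) (p q s : ℝ) : row a c (-p) (-q) (-s) = -row a c p q s := by
  simp only [row, map_neg]
  ring

/-- A row with top letter `s > 0` and at most one sign change (`¬(pq < 0 ∧ qs < 0)`) has positive derivative at each of its
positive roots. -/
theorem deriv_pos_at_root_of_oneChange_top_pos (a c : ℕ) (ha : 0 < a) (hac : a < c) (p q s : ℝ) (hs : 0 < s)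
    (hone : ¬ (p * q < 0 ∧ q * s < 0)) (t : ℝ) (ht : 0 < t) (hroot : (row a c p q s).eval t = 0) :
    0 < (derivative (row a c p q s)).eval t := by
  have hder := mul_eval_derivative_row a c p q s t
  rw [eval_row] at hroot
  have hta : 0 < t ^ a := pow_pos ht a
  have htc : 0 < t ^ c := pow_pos ht c
  have ha' : (0 : ℝ) < a := by exact_mod_cast ha
  have hac' : (a : ℝ) < c := by exact_mod_cast hac
  suffices h : 0 < t * (derivative (row a c p q s)).eval t from (mul_pos_iff_of_pos_left ht).1 h
  rw [hder]
  rcases le_or_gt 0 q with hq | hq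
  · -- `q ≥ 0`: both terms nonnegative, the top one positive
    nlinarith [mul_nonneg hq hta.le, mul_pos hs htc]
  · -- `q < 0`: one change forces `p ≤ 0`; use the root relation `q t^a = -p - s t^c`
    have hp : p ≤ 0 := by
      by_contra hp
      push Not at hp
      exact hone ⟨by nlinarith, by nlinarith⟩
    have hqt : q * t ^ a = -p - s * t ^ c := by linarith
    have : (a : ℝ) * q * t ^ a + (c : ℝ) * s * t ^ c = (a : ℝ) * (-p) + ((c : ℝ) - a) * (s * t ^ c) := by
      rw [mul_assoc (a : ℝ) q, hqt]; ring
    rw [this]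
    nlinarith [mul_pos (sub_pos.2 hac') (mul_pos hs htc), mul_nonneg ha'.le (neg_nonneg.2 hp)]

/-- **A nonzero one-change row has at most one positive root** (`0 < a < c`; elementary, no Descartes count needed). -/
theorem card_posRoots_row_le_one_of_oneChange (a c : ℕ) (ha : 0 < a) (hac : a < c) (p q s : ℝ)
    (hone : ¬ (p * q < 0 ∧ q * s < 0)) :
    ((row a c p q s).roots.toFinset.filter (fun t => 0 < t)).card ≤ 1 := by
  classical
  -- the negated row has the same roots and is one-change as well
  have hneg_roots : (row a c (-p) (-q) (-s)).roots = (row a c p q s).roots := by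
    rw [row_neg_letters, roots_neg]
  have hone' : ¬ (-p * -q < 0 ∧ -q * -s < 0) := by simpa only [neg_mul_neg] using hone
  rcases lt_trichotomy s 0 with hs | hs | hs
  · -- `s < 0`: negate
    rw [← hneg_roots]
    exact card_posRoots_le_one_of_deriv_pos _
      (deriv_pos_at_root_of_oneChange_top_pos a c ha hac (-p) (-q) (-s) (neg_pos.2 hs) hone')
  · -- `s = 0`: a binomial `p + q X^a`
    subst hs
    rcases lt_trichotomy q 0 with hq | hq | hq
    · rw [← hneg_roots]
      refine card_posRoots_le_one_of_deriv_pos _ fun t ht _ => ?_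
      have hder := mul_eval_derivative_row a c (-p) (-q) (-0) t
      have h : 0 < t * (derivative (row a c (-p) (-q) (-0))).eval t := by
        rw [hder]
        have ha' : (0 : ℝ) < a := by exact_mod_cast ha
        nlinarith [mul_pos (mul_pos ha' (neg_pos.2 hq)) (pow_pos ht a)]
      exact (mul_pos_iff_of_pos_left ht).1 h
    · subst hq
      have : row a c p 0 0 = C p := by simp [row]
      rw [this, roots_C, Multiset.toFinset_zero, filter_empty, card_empty]
      exact Nat.zero_le _
    · refine card_posRoots_le_one_of_deriv_pos _ fun t ht _ => ?_
      have hder := mul_eval_derivative_row a c p q 0 t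
      have h : 0 < t * (derivative (row a c p q 0)).eval t := by
        rw [hder]
        have ha' : (0 : ℝ) < a := by exact_mod_cast ha
        nlinarith [mul_pos (mul_pos ha' hq) (pow_pos ht a)]
      exact (mul_pos_iff_of_pos_left ht).1 h
  · exact card_posRoots_le_one_of_deriv_pos _ (deriv_pos_at_root_of_oneChange_top_pos a c ha hac p q s hs hone)

/-- **The product of `m` one-change rows has at most `m` distinct positive roots.** -/
theorem card_posRoots_prod_rows_le_of_oneChange (m a c : ℕ) (ha : 0 < a) (hac : a < c) (co : Fin m → ℝ × ℝ × ℝ)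
    (hone : ∀ j, ¬ ((co j).1 * (co j).2.1 < 0 ∧ (co j).2.1 * (co j).2.2 < 0)) :
    ((∏ j, row a c (co j).1 (co j).2.1 (co j).2.2).roots.toFinset.filter (fun t => 0 < t)).card ≤ m := by
  classical
  set Φ : ℝ[X] := ∏ j, row a c (co j).1 (co j).2.1 (co j).2.2 with hΦdef
  by_cases hΦ : Φ = 0
  · rw [hΦ, roots_zero, Multiset.toFinset_zero, filter_empty, card_empty]
    exact Nat.zero_le _
  have hrow : ∀ j, row a c (co j).1 (co j).2.1 (co j).2.2 ≠ 0 := by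
    intro j hj
    exact hΦ (prod_eq_zero (mem_univ j) hj)
  have hsub : Φ.roots.toFinset.filter (fun t => 0 < t) ⊆
      Finset.univ.biUnion (fun j => (row a c (co j).1 (co j).2.1 (co j).2.2).roots.toFinset.filter (fun t => 0 < t)) := by
    intro t ht
    rw [mem_filter, Multiset.mem_toFinset, mem_roots hΦ, IsRoot.def, hΦdef, eval_prod, prod_eq_zero_iff] at ht
    obtain ⟨⟨j, -, hj⟩, ht0⟩ := ht
    rw [mem_biUnion]
    refine ⟨j, mem_univ j, ?_⟩
    rw [mem_filter, Multiset.mem_toFinset, mem_roots (hrow j)]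
    exact ⟨hj, ht0⟩
  calc (Φ.roots.toFinset.filter (fun t => 0 < t)).card
      ≤ (Finset.univ.biUnion (fun j => (row a c (co j).1 (co j).2.1 (co j).2.2).roots.toFinset.filter
          (fun t => 0 < t))).card := card_le_card hsub
    _ ≤ ∑ j, ((row a c (co j).1 (co j).2.1 (co j).2.2).roots.toFinset.filter (fun t => 0 < t)).card := card_biUnion_le
    _ ≤ ∑ _j : Fin m, 1 := sum_le_sum fun j _ => card_posRoots_row_le_one_of_oneChange a c ha hac _ _ _ (hone j)
    _ = m := by simp

/-- **CONCAVITY BUDGET for a ONE-CHANGE company** (the floor's class; `0 < a < c`):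
`posCrit Φ ≤ 2·#{BAD positive critical points} + 3m + 1`. -/
theorem posCrit_prod_rows_le_concavityBudget_of_oneChange (m a c : ℕ) (ha : 0 < a) (hac : a < c)
    (co : Fin m → ℝ × ℝ × ℝ) (hone : ∀ j, ¬ ((co j).1 * (co j).2.1 < 0 ∧ (co j).2.1 * (co j).2.2 < 0)) :
    posCrit (∏ j, row a c (co j).1 (co j).2.1 (co j).2.2) ≤
      2 * (((derivative (∏ j, row a c (co j).1 (co j).2.1 (co j).2.2)).roots.toFinset.filter (fun t => 0 < t)).filter
          (fun t => (∏ j, row a c (co j).1 (co j).2.1 (co j).2.2).eval t ≠ 0 ∧ middleSum a c co t ≤ 0)).card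
        + 3 * m + 1 := by
  have h1 := posCrit_prod_rows_le_concavityBudget m a c ha hac co
  have h2 := card_posRoots_prod_rows_le_of_oneChange m a c ha hac co hone
  omega

/-- ★ **THE FLOOR IN BUDGET FORM** (`OneChangeFloorK3` of LINE (A), def #… of `Cruxes/MatrixDescartes/Lines/product_plus_one.lean`, its
`eulerNumerator d a 0` unfolded as in ✓ `card_posRoots_euler_bottom_eq_posCrit`): on every support `d₀ < d₁ < d₂` and for every
one-change company, `Z₊(eulerNumerator d a 0) ≤ 2·#{BAD positive critical points of ∏_j row (d₁−d₀) (d₂−d₀) a_{j·}} + 3m + 1`, where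
BAD = «not a root of the product and middle-letter Pick sum `M(t) = Σ_j a_{j1} t^{d₁−d₀}/g_j(t) ≤ 0`». -/
theorem floor_le_concavityBudget {m : ℕ} (d : Fin 3 → ℕ) (h01 : d 0 < d 1) (h12 : d 1 < d 2) (a : Fin m → Fin 3 → ℝ)
    (hone : ∀ j, ¬ (a j 0 * a j 1 < 0 ∧ a j 1 * a j 2 < 0)) :
    ((∑ j, (∑ l, C (a j l * ((d l : ℝ) - d 0)) * X ^ (d l)) * ∏ i ∈ Finset.univ.erase j, (∑ l, C (a i l) * X ^ (d l))
        : ℝ[X]).roots.toFinset.filter (fun t => 0 < t)).card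
      ≤ 2 * (((derivative (∏ j, row (d 1 - d 0) (d 2 - d 0) (a j 0) (a j 1) (a j 2))).roots.toFinset.filter
            (fun t => 0 < t)).filter
          (fun t => (∏ j, row (d 1 - d 0) (d 2 - d 0) (a j 0) (a j 1) (a j 2)).eval t ≠ 0 ∧
            middleSum (d 1 - d 0) (d 2 - d 0) (fun j => (a j 0, a j 1, a j 2)) t ≤ 0)).card + 3 * m + 1 := by
  rw [card_posRoots_euler_bottom_eq_posCrit d h01.le (h01.le.trans h12.le) a]
  exact posCrit_prod_rows_le_concavityBudget_of_oneChange m (d 1 - d 0) (d 2 - d 0) (by omega) (by omega)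
    (fun j => (a j 0, a j 1, a j 2)) (fun j => hone j)

/-- ★ **`OneChangeFloorK3` FROM A LINEAR BAD-POINT BUDGET** (the successor cut of the floor, card `arrangement-concavity-dip-count` C⁺ in
the kernel, for ALL companies — no genericity): if for some `C` every one-change company on every support `0 < u < w` has at most
`B·m + B` BAD positive critical points (`Φ′(t) = 0`, `Φ(t) ≠ 0`, `M(t) ≤ 0`), then the floor `OneChangeFloorK3` holds with constant
`2B + 3` — the conclusion below is the body of `OneChangeFloorK3` verbatim with `eulerNumerator d a 0` unfolded. -/
theorem oneChangeFloorK3_of_badBudget (B : ℕ)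
    (hbudget : ∀ (m u w : ℕ), 0 < u → u < w → ∀ (co : Fin m → ℝ × ℝ × ℝ),
      (∀ j, ¬ ((co j).1 * (co j).2.1 < 0 ∧ (co j).2.1 * (co j).2.2 < 0)) →
      (((derivative (∏ j, row u w (co j).1 (co j).2.1 (co j).2.2)).roots.toFinset.filter (fun t => 0 < t)).filter
          (fun t => (∏ j, row u w (co j).1 (co j).2.1 (co j).2.2).eval t ≠ 0 ∧ middleSum u w co t ≤ 0)).card
        ≤ B * m + B) :
    ∃ C' : ℕ, ∀ (m : ℕ) (d : Fin 3 → ℕ) (a : Fin m → Fin 3 → ℝ), d 0 < d 1 → d 1 < d 2 →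
      (∀ j, ¬ (a j 0 * a j 1 < 0 ∧ a j 1 * a j 2 < 0)) →
      ((∑ j, (∑ l, C (a j l * ((d l : ℝ) - d 0)) * X ^ (d l)) * ∏ i ∈ Finset.univ.erase j, (∑ l, C (a i l) * X ^ (d l))
          : ℝ[X]).roots.toFinset.filter (fun t => 0 < t)).card ≤ C' * m + C' := by
  refine ⟨2 * B + 3, fun m d a h01 h12 hone => ?_⟩
  have h1 := floor_le_concavityBudget d h01 h12 a hone
  have h2 : (((derivative (∏ j, row (d 1 - d 0) (d 2 - d 0) (a j 0) (a j 1) (a j 2))).roots.toFinset.filter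
            (fun t => 0 < t)).filter
          (fun t => (∏ j, row (d 1 - d 0) (d 2 - d 0) (a j 0) (a j 1) (a j 2)).eval t ≠ 0 ∧
            middleSum (d 1 - d 0) (d 2 - d 0) (fun j => (a j 0, a j 1, a j 2)) t ≤ 0)).card ≤ B * m + B :=
    hbudget m (d 1 - d 0) (d 2 - d 0) (by omega) (by omega) (fun j => (a j 0, a j 1, a j 2)) (fun j => hone j)
  have h3 : (2 * B + 3) * m + (2 * B + 3) = 2 * (B * m + B) + 3 * m + 1 + 2 := by ring
  rw [h3]
  omega

end ZeroChange

end Summit.ValiantsHypothesis.ValiantsHypothesis.Theorems.LacunarySymmetroidMatrixDescartes
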